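import Summits.ValiantsHypothesis.ValiantsHypothesis.Theorems.OrderedCountWindowTransfer
import Summits.ValiantsHypothesis.ValiantsHypothesis.Theorems.DepthWindowIMMPaths
import HarnessLib

/-!
# Ordered count window — flattening across a column set and the SEGMENT RANK BOUND (lens 6, g8, K4)

The multi-cut rank method of Chatterjee–Kush–Saraf–Shpilka [cite: ChatterjeeKushSarafShpilka2024,
Claim 1 and Lemma 4 (proof), §4] for ONE layer-local ordered program (`HasOsmWidthLE`,
`Theorems/OrderedCountWindowTransfer.lean`), made explicit and kernel-checked:

* `setFlattening S T` (§1): the flattening of a tensor `T : (Fin N → Fin n) → F` across a set `S` of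
  blocks — rows = letters of the blocks in `S`, columns = letters of the blocks outside `S`
  (Nisan's partial-coefficient matrix for an arbitrary, not necessarily sequential, cut).
* `rank_setFlattening_sum_prod_le` (§2, the factorisation lemma): if `T = ∑_s a_s ∏_m E_{m,s}` where the
  factor `E_{m,s}` only reads the blocks in `A m`, then
  `rank (setFlattening S T) ≤ #s · n ^ ∑_m min(|A m ∩ S|, |A m \ S|)` — factor through the letters of the
  SMALLER side of every `A m` (no Kronecker products, no rank multiplicativity: one matrix product).
* `rank_setFlattening_le_of_hasOsmWidthLE` (§3): a layer-local ordered program of width `w` with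
  `q * r` layers, cut into `q` SEGMENTS of `r` consecutive layers (`segment σ m` = the blocks read in
  segment `m`), has `rank (setFlattening S T) ≤ w ^ (q + 1) · n ^ ∑_m min(|segment m ∩ S|, |segment m \ S|)`
  (sum over the `w^{q+1}` state paths through the segment boundaries, `DepthWindow.bilin_imm_eq_sum_paths`,
  `DepthWindow.imm_blocks`, then §2).  This is the per-program half of the reservoir theorem
  (`Theorems/OrderedCountWindowReservoir.lean`); the other half is a balanced cut `S`.

[cite: ChatterjeeKushSarafShpilka2024, Claim 1, Lemma 4] [cite: Nisan1991Noncommutative, §2 (partial-coefficient matrices)]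
-/

noncomputable section

namespace Summit.ValiantsHypothesis.ValiantsHypothesis.Theorems.OrderedCountWindow

open Literature.Computability.AlgebraicComplexity Matrix

variable {F : Type*} [Field F]

/-! ## §1 Flattening a tensor across a set of blocks -/

section Flattening

variable {N n : ℕ}

/-- Glue a word from its letters on the blocks in `S` and its letters on the blocks outside `S`.
[cite: Nisan1991Noncommutative, §2] -/
def glueWord (S : Finset (Fin N)) (x : {c // c ∈ S} → Fin n) (y : {c // c ∉ S} → Fin n)
    (c : Fin N) : Fin n :=
  if h : c ∈ S then x ⟨c, h⟩ else y ⟨c, h⟩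

/-- On a block of `S` the glued word reads `x`. [folklore] -/
theorem glueWord_of_mem (S : Finset (Fin N)) (x : {c // c ∈ S} → Fin n) (y : {c // c ∉ S} → Fin n)
    {c : Fin N} (h : c ∈ S) : glueWord S x y c = x ⟨c, h⟩ := by
  unfold glueWord
  rw [dif_pos h]

/-- Outside `S` the glued word reads `y`. [folklore] -/
theorem glueWord_of_not_mem (S : Finset (Fin N)) (x : {c // c ∈ S} → Fin n)
    (y : {c // c ∉ S} → Fin n) {c : Fin N} (h : c ∉ S) : glueWord S x y c = y ⟨c, h⟩ := by
  unfold glueWord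
  rw [dif_neg h]

/-- **The flattening of a tensor across the block set `S`** (Nisan's partial-coefficient matrix for an
arbitrary cut): rows are the letter assignments of the blocks in `S`, columns those of the blocks
outside `S`, the entry is `T` at the glued word. [cite: Nisan1991Noncommutative, §2]
[cite: ChatterjeeKushSarafShpilka2024, §2 (the matrix `M_{f,S}`)] -/
def setFlattening (S : Finset (Fin N)) (T : (Fin N → Fin n) → F) :
    Matrix ({c // c ∈ S} → Fin n) ({c // c ∉ S} → Fin n) F :=
  Matrix.of fun x y => T (glueWord S x y)

omit [Field F] in
/-- Entries of the flattening. [folklore] -/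
@[simp] theorem setFlattening_apply (S : Finset (Fin N)) (T : (Fin N → Fin n) → F)
    (x : {c // c ∈ S} → Fin n) (y : {c // c ∉ S} → Fin n) :
    setFlattening S T x y = T (glueWord S x y) := rfl

/-- The flattening is additive. [folklore] -/
theorem setFlattening_sum {ι : Type*} (s : Finset ι) (S : Finset (Fin N))
    (T : ι → (Fin N → Fin n) → F) :
    setFlattening S (fun j => ∑ i ∈ s, T i j) = ∑ i ∈ s, setFlattening S (T i) := by
  ext x y
  simp [setFlattening, Matrix.sum_apply]

/-- The flattening of the zero tensor. [folklore] -/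
theorem setFlattening_zero (S : Finset (Fin N)) :
    setFlattening S (fun _ : Fin N → Fin n => (0 : F)) = 0 := by
  ext x y
  simp [setFlattening]

/-- A layer-local program of width `0` computes the zero tensor. [folklore] -/
theorem eq_zero_of_hasOsmWidthLE_zero {L d : ℕ} {κ : Fin L → Option (Fin d)}
    {T : (Fin d → Fin n) → F} (h : HasOsmWidthLE 0 κ T) : T = fun _ => 0 := by
  obtain ⟨C, u, v, -, hT⟩ := h
  funext j
  rw [hT j]
  simp [dotProduct]

end Flattening

/-! ## §2 The factorisation lemma: rank through the smaller side of every factor -/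

section Factor

variable {N n : ℕ}

/-- **Factorisation lemma.** If `T j = ∑_s a s · ∏_m E m s j` and the factor `E m s` reads only the
blocks in `A m`, then the flattening of `T` across `S` factors through the index
`(s, letters of ⋃_{m : |A m ∩ S| ≤ |A m \ S|} (A m ∩ S), letters of ⋃_{other m} (A m \ S))`, whence
`rank ≤ #s · n ^ ∑_m min(|A m ∩ S|, |A m \ S|)`.  (The sets `A m` need not be disjoint.)
[cite: ChatterjeeKushSarafShpilka2024, Claim 1 (proof: rank is multiplicative over the segments and
each segment has rank at most `n^{min}`)] -/
theorem rank_setFlattening_sum_prod_le [NeZero n] {k : ℕ} {ι : Type*} [Fintype ι]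
    (S : Finset (Fin N)) (A : Fin k → Finset (Fin N)) (a : ι → F)
    (E : Fin k → ι → (Fin N → Fin n) → F)
    (hE : ∀ m s j j', (∀ c ∈ A m, j c = j' c) → E m s j = E m s j') :
    (setFlattening S fun j => ∑ s, a s * ∏ m, E m s j).rank ≤
      Fintype.card ι * n ^ ∑ m, min (A m ∩ S).card (A m \ S).card := by
  classical
  -- the side of each factor and the two unions of smaller sides
  let Lside : Fin k → Prop := fun m => (A m ∩ S).card ≤ (A m \ S).card
  let UL : Finset (Fin N) := (Finset.univ.filter fun m => Lside m).biUnion fun m => A m ∩ S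
  let UR : Finset (Fin N) := (Finset.univ.filter fun m => ¬ Lside m).biUnion fun m => A m \ S
  have hULS : ∀ c ∈ UL, c ∈ S := by
    intro c hc
    obtain ⟨m, -, hm⟩ := Finset.mem_biUnion.1 hc
    exact (Finset.mem_inter.1 hm).2
  have hURS : ∀ c ∈ UR, c ∉ S := by
    intro c hc
    obtain ⟨m, -, hm⟩ := Finset.mem_biUnion.1 hc
    exact (Finset.mem_sdiff.1 hm).2
  have hAUL : ∀ m, Lside m → ∀ c ∈ A m, c ∈ S → c ∈ UL := by
    intro m hm c hc hcS
    exact Finset.mem_biUnion.2 ⟨m, Finset.mem_filter.2 ⟨Finset.mem_univ _, hm⟩,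
      Finset.mem_inter.2 ⟨hc, hcS⟩⟩
  have hAUR : ∀ m, ¬ Lside m → ∀ c ∈ A m, c ∉ S → c ∈ UR := by
    intro m hm c hc hcS
    exact Finset.mem_biUnion.2 ⟨m, Finset.mem_filter.2 ⟨Finset.mem_univ _, hm⟩,
      Finset.mem_sdiff.2 ⟨hc, hcS⟩⟩
  -- restriction to / extension from the unions
  let resL : ({c // c ∈ S} → Fin n) → ({c // c ∈ UL} → Fin n) :=
    fun x c => x ⟨c.1, hULS c.1 c.2⟩
  let resR : ({c // c ∉ S} → Fin n) → ({c // c ∈ UR} → Fin n) :=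
    fun y c => y ⟨c.1, hURS c.1 c.2⟩
  let extL : ({c // c ∈ UL} → Fin n) → ({c // c ∈ S} → Fin n) :=
    fun ξ c => if h : c.1 ∈ UL then ξ ⟨c.1, h⟩ else 0
  let extR : ({c // c ∈ UR} → Fin n) → ({c // c ∉ S} → Fin n) :=
    fun η c => if h : c.1 ∈ UR then η ⟨c.1, h⟩ else 0
  have hextL : ∀ x (c : {c // c ∈ S}), c.1 ∈ UL → extL (resL x) c = x c := by
    intro x c hc
    simp only [extL, resL, dif_pos hc]
  have hextR : ∀ y (c : {c // c ∉ S}), c.1 ∈ UR → extR (resR y) c = y c := by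
    intro y c hc
    simp only [extR, resR, dif_pos hc]
  -- agreement of the modified glued words on the blocks of a factor
  have hgL : ∀ m, Lside m → ∀ x y, ∀ c ∈ A m,
      glueWord S (extL (resL x)) y c = glueWord S x y c := by
    intro m hm x y c hc
    by_cases hcS : c ∈ S
    · rw [glueWord_of_mem S _ _ hcS, glueWord_of_mem S _ _ hcS]
      exact hextL x ⟨c, hcS⟩ (hAUL m hm c hc hcS)
    · rw [glueWord_of_not_mem S _ _ hcS, glueWord_of_not_mem S _ _ hcS]
  have hgR : ∀ m, ¬ Lside m → ∀ x y, ∀ c ∈ A m,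
      glueWord S x (extR (resR y)) c = glueWord S x y c := by
    intro m hm x y c hc
    by_cases hcS : c ∈ S
    · rw [glueWord_of_mem S _ _ hcS, glueWord_of_mem S _ _ hcS]
    · rw [glueWord_of_not_mem S _ _ hcS, glueWord_of_not_mem S _ _ hcS]
      exact hextR y ⟨c, hcS⟩ (hAUR m hm c hc hcS)
  -- the two factors of the flattening
  let Rm : Matrix ({c // c ∈ S} → Fin n) (ι × ({c // c ∈ UL} → Fin n) × ({c // c ∈ UR} → Fin n)) F :=
    Matrix.of fun x p => if resL x = p.2.1 then
      a p.1 * ∏ m ∈ Finset.univ.filter (fun m => ¬ Lside m), E m p.1 (glueWord S x (extR p.2.2))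
      else 0
  let Cm : Matrix (ι × ({c // c ∈ UL} → Fin n) × ({c // c ∈ UR} → Fin n)) ({c // c ∉ S} → Fin n) F :=
    Matrix.of fun p y => if resR y = p.2.2 then
      ∏ m ∈ Finset.univ.filter (fun m => Lside m), E m p.1 (glueWord S (extL p.2.1) y) else 0
  have hRC : Rm * Cm = setFlattening S (fun j => ∑ s, a s * ∏ m, E m s j) := by
    ext x y
    rw [Matrix.mul_apply, setFlattening_apply, Fintype.sum_prod_type]
    refine Finset.sum_congr rfl fun s _ => ?_
    rw [Fintype.sum_prod_type, Finset.sum_eq_single_of_mem (resL x) (Finset.mem_univ _)]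
    · rw [Finset.sum_eq_single_of_mem (resR y) (Finset.mem_univ _)]
      · simp only [Rm, Cm, Matrix.of_apply, if_true]
        have h1 : ∏ m ∈ Finset.univ.filter (fun m => ¬ Lside m),
            E m s (glueWord S x (extR (resR y))) =
            ∏ m ∈ Finset.univ.filter (fun m => ¬ Lside m), E m s (glueWord S x y) :=
          Finset.prod_congr rfl fun m hm =>
            hE m s _ _ (hgR m (Finset.mem_filter.1 hm).2 x y)
        have h2 : ∏ m ∈ Finset.univ.filter (fun m => Lside m),
            E m s (glueWord S (extL (resL x)) y) =
            ∏ m ∈ Finset.univ.filter (fun m => Lside m), E m s (glueWord S x y) :=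
          Finset.prod_congr rfl fun m hm =>
            hE m s _ _ (hgL m (Finset.mem_filter.1 hm).2 x y)
        rw [h1, h2, mul_assoc, mul_comm (∏ m ∈ Finset.univ.filter (fun m => ¬ Lside m),
          E m s (glueWord S x y)), Finset.prod_filter_mul_prod_filter_not]
      · intro η _ hη
        simp only [Rm, Cm, Matrix.of_apply, if_neg (Ne.symm hη), mul_zero]
    · intro ξ _ hξ
      refine Finset.sum_eq_zero fun η _ => ?_
      simp only [Rm, Matrix.of_apply, if_neg (Ne.symm hξ), zero_mul]
  -- count the middle index
  have hcardL : UL.card ≤ ∑ m ∈ Finset.univ.filter (fun m => Lside m),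
      min (A m ∩ S).card (A m \ S).card := by
    refine Finset.card_biUnion_le.trans (Finset.sum_le_sum fun m hm => ?_)
    rw [min_eq_left (Finset.mem_filter.1 hm).2]
  have hcardR : UR.card ≤ ∑ m ∈ Finset.univ.filter (fun m => ¬ Lside m),
      min (A m ∩ S).card (A m \ S).card := by
    refine Finset.card_biUnion_le.trans (Finset.sum_le_sum fun m hm => ?_)
    rw [min_eq_right (le_of_not_ge (Finset.mem_filter.1 hm).2)]
  have hcard : UL.card + UR.card ≤ ∑ m, min (A m ∩ S).card (A m \ S).card := by
    rw [← Finset.sum_filter_add_sum_filter_not Finset.univ (fun m => Lside m)]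
    exact Nat.add_le_add hcardL hcardR
  calc (setFlattening S fun j => ∑ s, a s * ∏ m, E m s j).rank
      = (Rm * Cm).rank := by rw [hRC]
    _ ≤ Rm.rank := Matrix.rank_mul_le_left _ _
    _ ≤ Fintype.card (ι × ({c // c ∈ UL} → Fin n) × ({c // c ∈ UR} → Fin n)) :=
        Matrix.rank_le_card_width _
    _ = Fintype.card ι * n ^ (UL.card + UR.card) := by
        simp only [Fintype.card_prod, Fintype.card_fun, Fintype.card_fin, Fintype.card_coe, pow_add]
    _ ≤ Fintype.card ι * n ^ ∑ m, min (A m ∩ S).card (A m \ S).card :=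
        Nat.mul_le_mul_left _ (Nat.pow_le_pow_right (Nat.pos_of_neZero n) hcard)

end Factor

/-! ## §3 One program, cut into segments -/

section Segment

variable {N n : ℕ}

/-- The blocks read in the `m`-th SEGMENT (layers `m r, …, m r + r - 1`) of a layered program with
`q * r` layers and reading map `σ`. [cite: ChatterjeeKushSarafShpilka2024, §4 (proof of Lemma 4:
"`S_{i,1} ∪ ⋯ ∪ S_{i,q}`, the `j`-th consecutive block of `r` variable sets in the order `σ_i`")] -/
def segment {q r : ℕ} (σ : Fin (q * r) → Fin N) (m : Fin q) : Finset (Fin N) :=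
  Finset.univ.image fun a : Fin r => σ ⟨(m : ℕ) * r + a, DepthWindow.blockIndex_lt m a⟩

/-- The block read at layer `m r + a` lies in segment `m`. [folklore] -/
theorem mem_segment {q r : ℕ} (σ : Fin (q * r) → Fin N) (m : Fin q) (a : Fin r) :
    σ ⟨(m : ℕ) * r + a, DepthWindow.blockIndex_lt m a⟩ ∈ segment σ m :=
  Finset.mem_image_of_mem _ (Finset.mem_univ a)

/-- A segment has at most `r` blocks. [folklore] -/
theorem card_segment_le {q r : ℕ} (σ : Fin (q * r) → Fin N) (m : Fin q) :
    (segment σ m).card ≤ r :=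
  Finset.card_image_le.trans (by simp)

/-- For an injective reading map every segment has exactly `r` blocks. [folklore] -/
theorem card_segment {q r : ℕ} {σ : Fin (q * r) → Fin N} (hσ : Function.Injective σ) (m : Fin q) :
    (segment σ m).card = r := by
  unfold segment
  rw [Finset.card_image_of_injective _ fun a a' h => ?_, Finset.card_univ, Fintype.card_fin]
  have h' := congrArg Fin.val (hσ h)
  simp only [Fin.ext_iff] at h' ⊢
  omega

/-- For an injective reading map distinct segments are disjoint. [folklore] -/
theorem disjoint_segment {q r : ℕ} {σ : Fin (q * r) → Fin N} (hσ : Function.Injective σ)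
    {m m' : Fin q} (hmm' : m ≠ m') : Disjoint (segment σ m) (segment σ m') := by
  rw [Finset.disjoint_left]
  intro c hc hc'
  obtain ⟨a, -, rfl⟩ := Finset.mem_image.1 hc
  obtain ⟨a', -, h⟩ := Finset.mem_image.1 hc'
  have h' := congrArg Fin.val (hσ h)
  simp only at h'
  apply hmm'
  have ha := a.isLt
  have ha' := a'.isLt
  rcases lt_trichotomy (m : ℕ) m' with hlt | heq | hgt
  · exfalso
    have : (m : ℕ) * r + r ≤ (m' : ℕ) * r := by
      calc (m : ℕ) * r + r = ((m : ℕ) + 1) * r := by ring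
        _ ≤ (m' : ℕ) * r := Nat.mul_le_mul_right _ hlt
    omega
  · exact Fin.ext heq
  · exfalso
    have : (m' : ℕ) * r + r ≤ (m : ℕ) * r := by
      calc (m' : ℕ) * r + r = ((m' : ℕ) + 1) * r := by ring
        _ ≤ (m : ℕ) * r := Nat.mul_le_mul_right _ hgt
    omega

/-- For a surjective reading map the segments cover all blocks. [folklore] -/
theorem exists_mem_segment {q r : ℕ} {σ : Fin (q * r) → Fin N} (hσ : Function.Surjective σ)
    (c : Fin N) : ∃ m, c ∈ segment σ m := by
  obtain ⟨p, rfl⟩ := hσ c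
  have hr : 0 < r := Nat.pos_of_ne_zero fun h => by
    have := p.isLt
    simp [h] at this
  refine ⟨⟨p / r, (Nat.div_lt_iff_lt_mul hr).2 p.isLt⟩, ?_⟩
  have hp : σ p = σ ⟨(p / r) * r + (⟨p % r, Nat.mod_lt _ hr⟩ : Fin r),
      DepthWindow.blockIndex_lt ⟨p / r, (Nat.div_lt_iff_lt_mul hr).2 p.isLt⟩ ⟨p % r, Nat.mod_lt _ hr⟩⟩ :=
    congrArg σ (Fin.ext (by simp [Nat.div_add_mod' p r]))
  rw [hp]
  exact mem_segment σ _ _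

/-- **Segment rank bound for one ordered program (Claim 1 of CKSS, explicit).** A layer-local
ordered program of width `w` with `q * r` layers, reading block `σ p` at layer `p`, computes a tensor
whose flattening across ANY block set `S` has rank at most
`w ^ (q + 1) · n ^ ∑_{m < q} min(|segment m ∩ S|, |segment m \ S|)`.
[cite: ChatterjeeKushSarafShpilka2024, Claim 1 (with `w^{q+1}` state paths through the `q - 1` inner
and two outer segment boundaries)] -/
theorem rank_setFlattening_le_of_hasOsmWidthLE [NeZero n] {q r w : ℕ} (σ : Fin (q * r) → Fin N)
    {T : (Fin N → Fin n) → F} (hT : HasOsmWidthLE w (fun p => some (σ p)) T) (S : Finset (Fin N)) :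
    (setFlattening S T).rank ≤
      w ^ (q + 1) * n ^ ∑ m : Fin q, min (segment σ m ∩ S).card (segment σ m \ S).card := by
  classical
  obtain ⟨C, u, v, hC, hTj⟩ := hT
  -- the segment products
  let M : Fin q → (Fin N → Fin n) → Matrix (Fin w) (Fin w) F := fun m j =>
    (List.ofFn fun a : Fin r => C ⟨(m : ℕ) * r + a, DepthWindow.blockIndex_lt m a⟩ j).prod
  have hM : ∀ m j j', (∀ c ∈ segment σ m, j c = j' c) → M m j = M m j' := by
    intro m j j' h
    simp only [M]
    congr 1
    refine List.ofFn_inj.2 (funext fun a => hC _ j j' fun c hc => ?_)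
    rw [Option.some_inj] at hc
    rw [← hc]
    exact h _ (mem_segment σ m a)
  have hTsum : ∀ j, T j = ∑ s : Fin (q + 1) → Fin w,
      (u (s 0) * v (s (Fin.last q))) * ∏ m, M m j (s m.castSucc) (s m.succ) := by
    intro j
    rw [hTj j, DepthWindow.imm_blocks (fun p => C p j)]
    have h1 : u ⬝ᵥ ((List.ofFn fun m => M m j).prod *ᵥ v) =
        ∑ i, ∑ k, u i * (List.ofFn fun m => M m j).prod i k * v k := by
      simp only [dotProduct, Matrix.mulVec, Finset.mul_sum, mul_assoc]
    rw [h1, DepthWindow.bilin_imm_eq_sum_paths]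
    refine Finset.sum_congr rfl fun s _ => ?_
    simp only [DepthWindow.pathWeight]
    ring
  rw [show T = fun j => ∑ s : Fin (q + 1) → Fin w,
      (u (s 0) * v (s (Fin.last q))) * ∏ m, M m j (s m.castSucc) (s m.succ) from funext hTsum]
  refine (rank_setFlattening_sum_prod_le S (segment σ) (fun s : Fin (q + 1) → Fin w =>
    u (s 0) * v (s (Fin.last q))) (fun m s j => M m j (s m.castSucc) (s m.succ))
    fun m s j j' h => by rw [hM m j j' h]).trans (le_of_eq ?_)
  rw [Fintype.card_fun, Fintype.card_fin, Fintype.card_fin]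

/-- Transport of a layer-local program along an equality of layer counts. [folklore] -/
theorem HasOsmWidthLE.castLayers {L L' d w : ℕ} (h : L = L') {κ : Fin L → Option (Fin d)}
    {T : (Fin d → Fin n) → F} (hT : HasOsmWidthLE w κ T) :
    HasOsmWidthLE w (fun p : Fin L' => κ (Fin.cast h.symm p)) T := by
  subst h
  exact hT

end Segment

end Summit.ValiantsHypothesis.ValiantsHypothesis.Theorems.OrderedCountWindow
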